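import Mathlib.LinearAlgebra.Dual.Lemmas
import Mathlib.LinearAlgebra.FiniteDimensional.Lemmas
import Mathlib.Algebra.Field.ZMod

/-!
# Crux `CubicForrelation.SignedCubicForrelationInPrBPP` (stmt-QuantumAdvantage-13933)

Stub `stub_heredity` of the line `polar-radical-seeds` (SEED HEREDITY, the linear-algebra lever).

Let `T` be a trilinear form on `𝔽₂ⁿ` that is symmetric (invariant under swapping the first two and the
last two arguments, hence under all of `S₃`), let `E` be a subspace with `T(E, E, ·) = 0` and
`n ≤ 2 dim E`, and for `ξ ∈ 𝔽₂ⁿ` let `R_ξ := ker (T ξ) = {v | T(ξ, v, ·) = 0}` be the first polar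
radical. Then `dim R_ξ ≤ 2 dim (E ∩ R_ξ)`.

Proof. The linear map `φ : E → (𝔽₂ⁿ)^*`, `e ↦ T(ξ, e, ·)` has kernel (inside) `E ∩ R_ξ`, and its
image lies in the dual annihilator of `E + R_ξ`: for `e, e' ∈ E`, `T(ξ, e, e') = T(e, e', ξ) = 0` by
symmetry and isotropy, and for `r ∈ R_ξ`, `T(ξ, e, r) = T(ξ, r, e) = 0`. Rank–nullity for `φ`,
`dim W + dim Ann(W) = n` for `W = E + R_ξ` and `dim (E + R) + dim (E ∩ R) = dim E + dim R` combine
(linear arithmetic) to `dim R_ξ ≤ n - 2 dim E + 2 dim (E ∩ R_ξ) ≤ 2 dim (E ∩ R_ξ)`.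

Everything is over Mathlib only (`ZMod 2` is a field through the global `Fact (Nat.Prime 2)`).
-/

noncomputable section

set_option linter.dupNamespace false -- D-0017: single-problem summit ⇒ `QuantumAdvantage.QuantumAdvantage` by design

namespace Summit.QuantumAdvantage.QuantumAdvantage.Theorems.SignedCubicForrelationInPrBPP

/-- For a symmetric trilinear form `T` on `𝔽₂ⁿ` isotropic on `E` (`T(E,E,·) = 0`), the partial map
`e ↦ T(ξ, e, ·)` sends `E` into the dual annihilator of `E ⊔ ker (T ξ)`. -/
private theorem stub_heredity_range_le {n : ℕ}
    (T : (Fin n → ZMod 2) →ₗ[ZMod 2] (Fin n → ZMod 2) →ₗ[ZMod 2] (Fin n → ZMod 2) →ₗ[ZMod 2] ZMod 2)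
    (E : Submodule (ZMod 2) (Fin n → ZMod 2))
    (hsym₁ : ∀ u v w, T u v w = T v u w) (hsym₂ : ∀ u v w, T u v w = T u w v)
    (hiso : ∀ e ∈ E, ∀ e' ∈ E, ∀ w, T e e' w = 0) (ξ : Fin n → ZMod 2) :
    LinearMap.range ((T ξ).domRestrict E) ≤ (E ⊔ LinearMap.ker (T ξ)).dualAnnihilator := by
  rw [Submodule.dualAnnihilator_sup_eq]
  refine le_inf ?_ ?_
  · rintro _ ⟨⟨e, he⟩, rfl⟩
    rw [Submodule.mem_dualAnnihilator]
    intro e' he'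
    rw [LinearMap.domRestrict_apply, hsym₁, hsym₂]
    exact hiso e he e' he' ξ
  · rintro _ ⟨⟨e, he⟩, rfl⟩
    rw [Submodule.mem_dualAnnihilator]
    intro r hr
    rw [LinearMap.domRestrict_apply, hsym₂, LinearMap.mem_ker.mp hr, LinearMap.zero_apply]

/-- The kernel of `e ↦ T(ξ, e, ·)` on `E` is no larger than `E ⊓ ker (T ξ)` (in fact they are
isomorphic; only the inequality of dimensions is needed). -/
private theorem stub_heredity_finrank_ker_le {n : ℕ}
    (T : (Fin n → ZMod 2) →ₗ[ZMod 2] (Fin n → ZMod 2) →ₗ[ZMod 2] (Fin n → ZMod 2) →ₗ[ZMod 2] ZMod 2)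
    (E : Submodule (ZMod 2) (Fin n → ZMod 2)) (ξ : Fin n → ZMod 2) :
    Module.finrank (ZMod 2) (LinearMap.ker ((T ξ).domRestrict E)) ≤
      Module.finrank (ZMod 2) ↥(E ⊓ LinearMap.ker (T ξ)) := by
  rw [← Submodule.finrank_map_subtype_eq E (LinearMap.ker ((T ξ).domRestrict E))]
  refine Submodule.finrank_mono ?_
  rintro _ ⟨⟨e, he⟩, hk, rfl⟩
  exact ⟨he, hk⟩

/-- SEED HEREDITY (stub `stub_heredity` of line `polar-radical-seeds`, crux stmt-QuantumAdvantage-13933).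
For a symmetric trilinear form `T` on `𝔽₂ⁿ` (symmetric in the first two and in the last two slots), a
subspace `E` with `T(E, E, ·) = 0` and `n ≤ 2 dim E`, every first polar radical `R_ξ = ker (T ξ)`
satisfies `dim R_ξ ≤ 2 dim (E ⊓ R_ξ)`. Proof: rank–nullity for `e ↦ T(ξ, e, ·) : E → Ann(E ⊔ R_ξ)`,
`dim W + dim Ann W = n` and `dim (E ⊔ R) + dim (E ⊓ R) = dim E + dim R`. -/
theorem stub_heredity : ∀ (n : ℕ)
    (T : (Fin n → ZMod 2) →ₗ[ZMod 2] (Fin n → ZMod 2) →ₗ[ZMod 2] (Fin n → ZMod 2) →ₗ[ZMod 2] ZMod 2)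
    (E : Submodule (ZMod 2) (Fin n → ZMod 2)),
    (∀ u v w, T u v w = T v u w) → (∀ u v w, T u v w = T u w v) →
    (∀ e ∈ E, ∀ e' ∈ E, ∀ w, T e e' w = 0) →
    n ≤ 2 * Module.finrank (ZMod 2) E →
    ∀ ξ : Fin n → ZMod 2,
      Module.finrank (ZMod 2) (LinearMap.ker (T ξ)) ≤
        2 * Module.finrank (ZMod 2) ↥(E ⊓ LinearMap.ker (T ξ)) := by
  intro n T E hsym₁ hsym₂ hiso hn ξ
  -- (1) rank–nullity for `φ := (T ξ)|_E : E → Dual`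
  have h₁ : Module.finrank (ZMod 2) ↥(LinearMap.range ((T ξ).domRestrict E)) +
      Module.finrank (ZMod 2) ↥(LinearMap.ker ((T ξ).domRestrict E)) =
        Module.finrank (ZMod 2) ↥E :=
    LinearMap.finrank_range_add_finrank_ker _
  -- (2) `range φ ⊆ Ann(E ⊔ R)`
  have h₂ : Module.finrank (ZMod 2) ↥(LinearMap.range ((T ξ).domRestrict E)) ≤
      Module.finrank (ZMod 2) ↥(E ⊔ LinearMap.ker (T ξ)).dualAnnihilator :=
    Submodule.finrank_mono (stub_heredity_range_le T E hsym₁ hsym₂ hiso ξ)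
  -- (3) `dim W + dim Ann(W) = n`
  have h₃ : Module.finrank (ZMod 2) ↥(E ⊔ LinearMap.ker (T ξ)) +
      Module.finrank (ZMod 2) ↥(E ⊔ LinearMap.ker (T ξ)).dualAnnihilator = n := by
    have := Subspace.finrank_add_finrank_dualAnnihilator_eq (K := ZMod 2) (E ⊔ LinearMap.ker (T ξ))
    rwa [Module.finrank_fin_fun] at this
  -- (4) modularity of dimension
  have h₄ : Module.finrank (ZMod 2) ↥(E ⊔ LinearMap.ker (T ξ)) +
      Module.finrank (ZMod 2) ↥(E ⊓ LinearMap.ker (T ξ)) =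
        Module.finrank (ZMod 2) ↥E + Module.finrank (ZMod 2) ↥(LinearMap.ker (T ξ)) :=
    Submodule.finrank_sup_add_finrank_inf_eq _ _
  -- (5) `ker φ ↪ E ⊓ R`
  have h₅ : Module.finrank (ZMod 2) ↥(LinearMap.ker ((T ξ).domRestrict E)) ≤
      Module.finrank (ZMod 2) ↥(E ⊓ LinearMap.ker (T ξ)) :=
    stub_heredity_finrank_ker_le T E ξ
  omega

end Summit.QuantumAdvantage.QuantumAdvantage.Theorems.SignedCubicForrelationInPrBPP
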